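import Summits.Ventures.HSemireg.Pad4TowerUniverseU6

/-!
# Venture HSemireg — PAD-4: the X-COLLAPSE of U6 in kernel form, (F1ℝ) slice — every `N`-cell with an O-factor and a unit letter
# is X-PHASE-dead (alphabet-free), and a RULE-D-closed support free of them has μ = 0: U6 is closed modulo LEMMA X-PHASE

HONEST FRAMING. Lean index of the computation cell `pub-hsemireg` (S4-PUSH, H2 door PAD-4); seat `hodge-semireg-assembly-p1`
(director-hodge g7∕g8 WIDTH-LEVER W2 on stmt-HodgeConjecture-18881: «the universe-closure census entries as Lean theorems from the
tower files»). `Pad4TowerUniverseU6` typed the ×2'd REDUCTION of U6 (A∪2I′ species + Ψ: alive part = decorated class-y cores; U6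
NOT closed that way). The cell's NEXT move closes U6 (and U7⁺, U8) differently — the **X-COLLAPSE** (census entry-5 candidate
«X-COLLAPSE U6∕U7⁺∕U8 + S(D_T2)» adca5a601d927b9f, director-hodge g7 l.30504; chain bc5-plan g3 l.30489 (a)–(d); ×2 s4-ref g73
5f7ec243906f3e2e: «(a) N-orbits with ≥ 1 O and ≥ 1 ℓ: 21∕28∕36 … every (O, ℓ_u) pair LIVE with EXACTLY ONE absorbing kind = the
σ-leg of the own direction u supplied by q = Z[ℓ_u ↦ O] … U-free; (c) core(M* − Z_X) = 14∕29∕30; (d) Ψ = 0 on 14∕14 …»): LEMMA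
X-PHASE (PAD4-BALANCED §22; typed as `Pad4TowerLemmaA2I.XPhaseDead` on (F1ℝ)) kills every `N`-class `Z_X` = «an O-factor and a UNIT
letter ℓ_u» — the partner `q = Z[ℓ_u ↦ O]` has its node pinned by the row of the phase sibling `Z[ℓ_u ↦ ℓ_w]` — and the RULE-D core
of what remains, M*_X(U), is Ψ-null and (for U6) fully-charged-free. This file is the U6 leg on the (F1ℝ) SLICE (phases `±1`;
the only sibling direction is `w = ū`), over the typed predicates: RULE D of `Pad4TowerLemmaT`, `XPhaseDead` of `Pad4TowerLemmaA2I`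
§7, the fixpoint checker `Pad4TowerRuleDFixpoint`, M*(U6) of `Pad4TowerUniverseU6`.

CONTENT. §1 `SideClosed` (phase closure of a support AT ITS O-CARRYING CELLS: one factor's sides swapped stays in — there a consequence
of G-closure, the O-factor absorbing the phase-product constraint of `H`; not demanded for fully charged cells, E-U6X-1),
`xPhaseDead_of_unit_letter` PROVED (ALPHABET-FREE: O-factor
`f`, unit pure ray on `σ`, sibling present ⇒ `XPhaseDead C Z σ u f`; (H-b) weak∕strong automatic at an O-factor, (H-a) automatic at
the floor partner, (H-c) = the sibling at `e = 1`, (H-d) vacuous), `ZXKey`, `zx_xPhaseDead`. §2 the X-stage certificate `u6RoundsX`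
(6 rounds from (M*(U6) `N`-shapes without O-next-to-ℓ, M*(U6) `P`-shapes); this seat's `sim/` mirror: 9 `N` + 5 `P` shapes survive =
the 14 orbits of record, all O-carrying, all Ψ-null — `u6RoundsX_ok`, decide) and `u6_zxFree_subset_Mx`. §3 `u6_xcollapse`: (1)
phase-closed `N`-support ⇒ every Z_X constituent is `XPhaseDead`; (2) Z_X-free RULE-D-closed support ⇒ `μ = 0` (no Ψ-row needed).

WHAT IS NOT HERE ∕ NOT IN LEAN. The (E1)-meaning of `XPhaseDead` (LEMMA X-PHASE: pencil, steps (i)(ii) ×2 s4-ref g72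
9150caba90bff308, (iii) inherited) — hence (2)'s hypothesis is not discharged by (1) inside Lean, exactly as for `A2IDead` in
`Pad4TowerUniverseDT1`; the μ₄ phases `±i` and the μ₄ siblings `w = ±iu` (`Pad4TowerCrossPhase.XPhaseDeadMu4`); U7⁺ and U8 (same
checker, larger alphabets — not in this file); S(D_T2). Nothing is a statement about a variety, a sheaf, σ, a seed or an abelian
variety; NOTHING HERE SAYS THAT HC ∕ HC_CM ∕ HC_AV ∕ W₆ ∕ HC_Kum4Type HOLDS OR FAILS. No `instance`, no notation, no named fact,
0 `sorry`; axioms standard.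

SOURCES (sha16): census entry-5 candidate words adca5a601d927b9f (director-hodge g7 l.30504); bc5-plan g3 l.30489 + memo v3.2 §13 (H),
`work/MstarX.json`; s4-ref g73 verdict 5f7ec243906f3e2e (l.30549) + mode-I strike 338a11775cdb217f; PAD4-BALANCED-search-1.md v2.3∕v2.5 §22;
`Pad4TowerLemmaA2I.lean` f584dd8287830a21 §7 (`XPhaseDead`); `Pad4TowerUniverseU6.lean` (this seat).
-/

namespace Summit.Ventures.HSemireg.Pad4Tower

open Finset

/-! ## §1 The alphabet-free X-PHASE kill of an O-factor next to a unit letter -/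

/-- **phase closure of a support at its O-CARRYING cells** (for a class with an O-factor, G-closure — `G = H ⋊ S₄`, `H` the
phase vectors of product `1` — supplies every phase vector of the charged factors, the O-factor absorbing the product constraint;
in particular the single side swap used here. Demanded ONLY for cells with an O-factor: for a fully charged cell a single swap is an
odd vector, not a real point of `G` — hodge-lit-semireg-ref g17, E-U6X-1): swapping the two light-cone sides of one factor of an
O-carrying cell keeps the cell in the support. -/
abbrev SideClosed (S : Finset Cell) : Prop :=
  ∀ Z ∈ S, (0, 0) ∈ Z.key → ∀ σ : Fin 4, (fun g r => if g = σ then Z g r.rev else Z g r) ∈ S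

/-- **LEMMA X-PHASE KILLS EVERY `N`-CELL WITH AN O-FACTOR AND A UNIT LETTER, in any alphabet** (the kill of the X-collapse, s4-ref g73
5f7ec243906f3e2e leg (a): «every (O, ℓ_u) pair LIVE with exactly one absorbing kind = the σ-leg of the own direction u supplied by
q = Z[ℓ_u ↦ O] … U-free for any alphabet inside the closed future cone of a unique apex O»; §22 REMARK (2)): if `Z` has the O-factor
`f` and the unit pure ray `ℓ_u` on `σ ≠ f`, and the phase sibling `Z[ℓ_u ↦ ℓ_ū]` is an `N`-cell, then `XPhaseDead C Z σ u f`
(`Pad4TowerLemmaA2I` §7): the entry is demanded against the O-factor, nothing lies below `Z` on `f` (it is `O`), a present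
`u`-partner is the full cancellation `q = Z[ℓ_u ↦ O]`, nothing lies below `q` on `σ` (its `σ`-letter is `O`), the sibling is the
`ū`-server of `q` at height `e = 1`, and no `P` sits strictly between heights 0 and 1. Pencil meaning (NOT in Lean): `Z` violates (E1). -/
theorem xPhaseDead_of_unit_letter (C : Config) {Z : Cell} {σ f : Fin 4} {u : Fin 2} (hσf : σ ≠ f) (hO : isO Z f)
    (hray : pureRay Z σ u) (h1 : Z σ u = 1) (hsib : (fun g r => if g = σ then Z g r.rev else Z g r) ∈ C.lower) :
    XPhaseDead C Z σ u f := by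
  have hf0 : ∀ r : Fin 2, Z f r = 0 := fun r => by fin_cases r; exacts [hO.1, hO.2]
  refine ⟨hσf, ⟨0, by show Z σ u ≠ Z f 0; rw [h1, hf0]; decide⟩, ?_, ?_, ?_⟩
  · intro P _ hle
    have h0 := hle f 0; have h1' := hle f 1
    rw [hf0] at h0 h1'
    constructor <;> omega
  · intro P _ hle
    have h0 := hle f 0 hσf.symm; have h1' := hle f 1 hσf.symm
    rw [hf0] at h0 h1'
    constructor <;> omega
  · rintro q hq ⟨hag, hlt⟩
    have hq0 : q σ u = 0 := by omega
    refine ⟨fun P _ _ hltP => absurd (hq0 ▸ hltP : P σ u < 0) (Nat.not_lt_zero _), _, hsib, ?_, ?_, ?_⟩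
    · intro g r hgr
      show (if g = σ then Z g r.rev else Z g r) = q g r
      by_cases hg : g = σ
      · subst hg
        have hr : r = u := by
          by_contra hru; exact hgr ⟨rfl, Fin2.eq_rev_of_ne r u hru⟩
        rw [if_pos rfl, hr, hray.2, hq0]
      · rw [if_neg hg, hag g r (fun h => hg h.1)]
    · show q σ u.rev < (if σ = σ then Z σ u.rev.rev else Z σ u.rev)
      rw [if_pos rfl, Fin.rev_rev, h1, hag σ u.rev (fun h => absurd h.2 (by fin_cases u <;> decide)), hray.2]
      decide
    · intro P _ _ hltP hlt'
      have : (if σ = σ then Z σ u.rev.rev else Z σ u.rev) = 1 := by rw [if_pos rfl, Fin.rev_rev, h1]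
      rw [this] at hlt'
      rw [hag σ u.rev (fun h => absurd h.2 (by fin_cases u <;> decide)), hray.2] at hltP
      omega

/-- the shapes attacked: an O-factor and a unit letter `ℓ`. -/
abbrev ZXKey (K : Multiset (ℕ × ℕ)) : Prop := (0, 0) ∈ K ∧ (1, 0) ∈ K

/-- **every `N`-cell of a support phase-closed at its O-carrying cells, whose shape has an O-factor and a unit letter, is
X-PHASE-dead** (for some pair (σ, f) and direction). -/
theorem zx_xPhaseDead (C : Config) (hS : SideClosed C.lower) {Z : Cell} (hZ : Z ∈ C.lower) (hk : ZXKey Z.key) :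
    ∃ σ f : Fin 4, ∃ u : Fin 2, XPhaseDead C Z σ u f := by
  obtain ⟨f, hf⟩ := exists_of_mem_key hk.1
  obtain ⟨σ, hσ⟩ := exists_of_mem_key hk.2
  obtain ⟨u, hray⟩ := exists_pureRay_of_nl hσ (by decide)
  have h1 : Z σ u = 1 := by have := nl_of_pureRay hray; rw [hσ] at this; exact ((Prod.mk.injEq _ _ _ _).mp this).1.symm
  have hσf : σ ≠ f := fun h => by rw [h, hf] at hσ; exact absurd hσ (by decide)
  exact ⟨σ, f, u, xPhaseDead_of_unit_letter C hσf ((nl_eq_zero_iff Z f).1 hf) hray h1 (hS Z hZ hk.1 σ)⟩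

/-! ## §2 The X-collapse of U6: RULE-D-closed supports free of those shapes lie in M*_X(U6) (= bc5-plan g3's core, 14 orbits) -/

/-- the X-stage deletion rounds of U6^ℝ, starting from (M*(U6) `N`-shapes without an O-next-to-ℓ, M*(U6) `P`-shapes). -/
def u6RoundsX : List Round :=
  [ -- round 1: 0 N-shapes and 7 P-shapes leave
    ([],
     [⟨{lO, lO, l1, l1}, l1, true, lO, true⟩, ⟨{lO, lO, l1, l2}, l2, true, lO, true⟩,
      ⟨{lO, lO, l1, t2Il}, t2Il, true, lO, true⟩, ⟨{lO, lO, l1, l3}, l3, true, lO, true⟩,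
      ⟨{lO, l1, l1, l1}, l1, true, l1, false⟩, ⟨{lO, l1, l1, l2}, l1, true, l2, true⟩,
      ⟨{lO, l1, l2, l2}, l2, true, l2, false⟩]),
    -- round 2: 9 N-shapes and 0 P-shapes leave
    ([⟨{lO, lO, l2, t2Il}, l2, false, t2Il, true⟩, ⟨{lO, lO, t2Il, t2Il}, t2Il, true, lO, true⟩,
      ⟨{lO, lO, t2Il, l3}, t2Il, true, l3, false⟩, ⟨{lO, lO, l3, t2I2l}, t2I2l, true, l3, false⟩,
      ⟨{lO, l2, l2, t2Il}, l2, false, t2Il, true⟩, ⟨{l1, l1, l1, l1}, l1, true, l1, false⟩,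
      ⟨{l1, l1, l1, l2}, l1, true, l1, false⟩, ⟨{l1, l1, l2, l2}, l1, true, l1, false⟩,
      ⟨{l1, l2, l2, l2}, l1, false, l2, true⟩],
     []),
    -- round 3: 0 N-shapes and 5 P-shapes leave
    ([],
     [⟨{lO, lO, lO, t2Il}, t2Il, false, lO, true⟩, ⟨{lO, lO, l2, t2Il}, l2, true, t2Il, false⟩,
      ⟨{lO, lO, l2, l3}, l2, false, l3, true⟩, ⟨{lO, lO, l3, l3}, l3, true, l3, false⟩,
      ⟨{l1, l1, l1, l1}, l1, true, l1, false⟩]),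
    -- round 4: 4 N-shapes and 0 P-shapes leave
    ([⟨{lO, lO, l2, t2I2l}, t2I2l, false, l2, false⟩, ⟨{lO, l2, l2, l3}, l2, true, l2, false⟩,
      ⟨{lO, l2, l3, l3}, l2, true, l3, false⟩, ⟨{lO, l3, l3, l3}, l3, true, l3, false⟩],
     []),
    -- round 5: 0 N-shapes and 2 P-shapes leave
    ([],
     [⟨{lO, lO, lO, t2I2l}, t2I2l, true, lO, true⟩, ⟨{lO, l2, l2, l2}, l2, true, l2, false⟩]),
    -- round 6: 1 N-shapes and 0 P-shapes leave
    ([⟨{l2, l2, l2, l2}, l2, true, l2, false⟩],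
     []) ]

/-- **M*_X(U6), `N`-side** (9 shapes). -/
def u6MxN : List (Multiset (ℕ × ℕ)) :=
  [ {lO, lO, lO, lO}, {lO, lO, lO, l2}, {lO, lO, lO, t2Il}, {lO, lO, lO, l3}, {lO, lO, lO, t2I2l}, {lO, lO, l2, l2},
    {lO, lO, l2, l3}, {lO, lO, l3, l3}, {lO, l2, l2, l2} ]

/-- **M*_X(U6), `P`-side** (5 shapes; 9 + 5 = 14 = bc5-plan g3's core ∕ s4-ref g73 (c) «M*_X = 14», all O-carrying hence phase-free). -/
def u6MxP : List (Multiset (ℕ × ℕ)) :=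
  [ {lO, lO, lO, lO}, {lO, lO, lO, l1}, {lO, lO, lO, l2}, {lO, lO, lO, l3}, {lO, lO, l2, l2} ]

/-- the X-stage certificate checks out (from the codes of M*(U6)'s `N`-shapes without O-next-to-ℓ and of M*(U6)'s `P`-shapes),
and EVERY survivor has an O-factor and Ψ = 0 (s4-ref g73 (d): «Ψ = 0 on 14∕14»). [kernel, `decide`] -/
theorem u6RoundsX_ok :
    CertsInj u6Keys u6RoundsX ∧
    roundsOK 3 ((u6MstarN.filter fun K => ¬ ZXKey K).map kenc) (u6MstarP.map kenc) u6RoundsX = true ∧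
      (∀ K ∈ u6Keys, kenc K ∈ finalN ((u6MstarN.filter fun K => ¬ ZXKey K).map kenc) (u6MstarP.map kenc) u6RoundsX ↔
        K ∈ u6MxN) ∧
      (∀ K ∈ u6Keys, kenc K ∈ finalP ((u6MstarN.filter fun K => ¬ ZXKey K).map kenc) (u6MstarP.map kenc) u6RoundsX ↔
        K ∈ u6MxP) ∧
      (∀ K ∈ u6MxN ++ u6MxP, (0, 0) ∈ K ∧ psiKey K = 0) := by
  decide +kernel

/-- **X-STAGE**: a RULE-D-closed configuration inside U6^ℝ none of whose `N`-cells has an O-factor next to a unit letter has all its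
shapes in M*_X(U6). -/
theorem u6_zxFree_subset_Mx (C : Config) (hC : RuleDClosed C) (hN : ∀ Z ∈ C.lower, InU6 Z) (hP : ∀ P ∈ C.upper, InU6 P)
    (hfree : ∀ Z ∈ C.lower, ¬ ZXKey Z.key) :
    (∀ Z ∈ C.lower, Z.key ∈ u6MxN) ∧ (∀ P ∈ C.upper, P.key ∈ u6MxP) := by
  obtain ⟨hMN, hMP⟩ := u6_support_subset_Mstar C hC hN hP
  obtain ⟨hinj, hok, hdecN, hdecP, -⟩ := u6RoundsX_ok
  have hUN : ∀ Z ∈ C.lower, Z.key ∈ u6Keys := fun Z hZ => key_mem_u6Keys (hN Z hZ)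
  have hUP : ∀ P ∈ C.upper, P.key ∈ u6Keys := fun P hPu => key_mem_u6Keys (hP P hPu)
  obtain ⟨hfN, hfP⟩ := rounds_sound hC hUN hUP (fun N hNl => coordBounded_of_letters u6Keys_spec.2 (hN N hNl)) u6RoundsX
    _ _ hinj hok (fun Z hZ => List.mem_map_of_mem (List.mem_filter.2 ⟨hMN Z hZ, decide_eq_true (hfree Z hZ)⟩))
    (fun P hPu => List.mem_map_of_mem (hMP P hPu))
  exact ⟨fun Z hZ => (hdecN _ (hUN Z hZ)).1 (hfN Z hZ), fun P hPu => (hdecP _ (hUP P hPu)).1 (hfP P hPu)⟩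

/-! ## §3 U6 is closed at first order modulo LEMMA X-PHASE -/

/-- **THE X-COLLAPSE OF U6 — (F1ℝ) SLICE, KERNEL FORM** (census entry-5 candidate «X-COLLAPSE U6∕U7⁺∕U8» adca5a601d927b9f, U6 leg;
bc5-plan g3 chain (a)–(d) l.30489, ×2 s4-ref g73 5f7ec243906f3e2e legs (a)(c)(d)): for a two-level (F1ℝ) design with letters in
`{O, ℓ, 2ℓ, 3ℓ, 2I+ℓ, 2I+2ℓ}` and RULE-D-closed support, (1) if the `N`-support is phase-closed AT ITS O-CARRYING CELLS (`SideClosed` —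
there implied by G-closure), EVERY `N`-constituent whose shape has an O-factor and a unit letter satisfies the typed LEMMA-X-PHASE kill
`XPhaseDead` (`zx_xPhaseDead`, alphabet-free); (2) if NO `N`-constituent has such a shape (the pencil consequence of (1): dead
constituents cannot occur in an (E1)-alive design — a HYPOTHESIS here), then `μ = 0`, i.e. (H1) fails, WITHOUT any Ψ-row (every
shape of M*_X(U6) carries an O-factor). NOT IN LEAN: the (E1)-meaning of `XPhaseDead` (LEMMA X-PHASE §22, pencil ×2 s4-ref g72 for
steps (i)(ii)); the μ₄ phases `±i` (`XPhaseDeadMu4` of `Pad4TowerCrossPhase` is the μ₄ predicate; the RULE-D part needs a μ₄ RULE D).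
Nothing here says HC ∕ HC_CM ∕ HC_AV holds or fails. -/
theorem u6_xcollapse (lower upper : List Cell) (hN : ∀ Z ∈ lower, InU6 Z) (hP : ∀ P ∈ upper, InU6 P)
    (hD : RuleDClosed ⟨lower.toFinset, upper.toFinset⟩) :
    (SideClosed lower.toFinset → ∀ Z ∈ lower, ZXKey Z.key →
        ∃ σ f : Fin 4, ∃ u : Fin 2, XPhaseDead ⟨lower.toFinset, upper.toFinset⟩ Z σ u f) ∧
      ((∀ Z ∈ lower, ¬ ZXKey Z.key) → muC lower upper = 0) := by
  refine ⟨fun hS Z hZ hk => zx_xPhaseDead _ hS (List.mem_toFinset.2 hZ) hk, fun hfree => ?_⟩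
  obtain ⟨hinN, hinP⟩ := u6_zxFree_subset_Mx _ hD (fun Z hZ => hN Z (List.mem_toFinset.1 hZ))
    (fun P hPu => hP P (List.mem_toFinset.1 hPu)) fun Z hZ => hfree Z (List.mem_toFinset.1 hZ)
  have hall := u6RoundsX_ok.2.2.2.2
  have hz : ∀ l : List Cell, (∀ X ∈ l, X.key ∈ u6MxN ++ u6MxP) → (l.map muTermC).sum = 0 := fun l hl =>
    List.sum_eq_zero fun x hx => by
      obtain ⟨X, hX, rfl⟩ := List.mem_map.1 hx
      obtain ⟨f, hf⟩ := exists_of_mem_key (hall _ (hl X hX)).1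
      exact muTermC_eq_zero_of_O hf
  unfold muC
  rw [hz lower fun X hX => List.mem_append_left _ (hinN X (List.mem_toFinset.2 hX)),
    hz upper fun X hX => List.mem_append_right _ (hinP X (List.mem_toFinset.2 hX)), sub_zero]

end Summit.Ventures.HSemireg.Pad4Tower
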